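import Mathlib.Algebra.BigOperators.Field
import Summits.RiemannHypothesis.RiemannHypothesis.Theorems.WeilCombCombShapePositivityDivisorGapTwoBlock

/-!
# Flow decoupling of the odd-block inequality `R(M)` of the divisor-graph Dirichlet gap
(towards stub `stub_divisorGapOddBlock24`, line `Sketch` of crux `WeilComb.CombShapePositivity`,
item stmt-RiemannHypothesis-11229, plan id B6; companion of `…DivisorGapParityStep`)

In the gauge `b_r = √r y_r`, `π_r = 1/r`, `R(M)` (hypothesis `hR` of `divisorGap_parityStep`) reads
`Var_O(b) + K |⟨w, b⟩|² ≤ E_O(b)` on the odd `r ≤ M`: a Poincaré inequality for the odd divisor graph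
(edges `r — nr`, `n` odd prime power, conductance `Λ(n)/(nr)`) plus ONE rank-one term,
`w_r = π_r (θ_r/πE − 1/πO)`, `θ_r = 1 − 2^{-⌊log₂(M/r)⌋}`, `K = log 2·πO·πE/(log 2·H_M − πO)`.
`oddBlock_of_gap_of_flow` splits `R(M)` into a PLAIN Poincaré inequality `c·Var_O ≤ E_O` and a
`y`-free certificate `w = div G + ρ` (`G` a flow on the edges, `Σρ = 0`) with `K·energy(G) ≤ κ₁`,
`K·Σ r ρ_r² ≤ κ₀`, `(1 + (1+1/t)κ₀)/c + (1+t)κ₁ ≤ 1`: discrete Green identity (`sum_mul_flowDiv_eq`),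
Cauchy–Schwarz along the edges (`norm_sq_flow_pairing_le`) and against the variance
(`norm_sq_sum_mul_le_mul_variance`).  Numerics (pure python): `R(M)` holds with margin
`≥ 0.3885·Σ_O‖y_r‖²` for all `24 ≤ M ≤ 400` (`= gap(G₃(M)) − 1` up to `3·10⁻³`; `0.54` at `M = 2000`),
and the optimal `K‖w‖²_{E_O⁻¹}` is `≤ 0.192` for every `24 ≤ M ≤ 400` (`≈ 1.3/log²M`), so `c = 5/4`,
`κ₁ = 1/5`, `κ₀ = 0` is admissible there.  NOT proved here: the plain gap `c` and the certificate (the two residual lemmas).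
-/

noncomputable section

-- the sub-problem path RiemannHypothesis/RiemannHypothesis duplicates a namespace (D-0017)
set_option linter.dupNamespace false

open scoped BigOperators
open Finset ArithmeticFunction

namespace Summit.RiemannHypothesis.RiemannHypothesis.Theorems.WeilCombBohrFejer

/-! ## Two Cauchy–Schwarz inequalities -/

/-- The variance identity in the gauge `b_r = √r y_r`: for a finite set `S` of positive integers and the
`π`-mean `m = (Σ_S y_r r^{-1/2}) / (Σ_S 1/r)`,
`Σ_{r ∈ S} (1/r) ‖√r y_r − m‖² = Σ_S ‖y_r‖² − |Σ_S y_r r^{-1/2}|² / Σ_S (1/r)`. -/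
theorem sum_div_norm_sub_mean_sq (S : Finset ℕ) (hS : ∀ r ∈ S, 1 ≤ r) (hS0 : S.Nonempty)
    (y : ℕ → ℂ) :
    ∑ r ∈ S, (1 : ℝ) / r * ‖((Real.sqrt r : ℝ) : ℂ) * y r -
        (∑ s ∈ S, y s * ((Real.sqrt (s : ℝ) : ℝ) : ℂ)⁻¹) / ((∑ s ∈ S, (1 : ℝ) / s : ℝ) : ℂ)‖ ^ 2 =
      ∑ r ∈ S, ‖y r‖ ^ 2 -
        ‖∑ r ∈ S, y r * ((Real.sqrt (r : ℝ) : ℝ) : ℂ)⁻¹‖ ^ 2 / (∑ r ∈ S, (1 : ℝ) / r) := by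
  set P := ∑ s ∈ S, (1 : ℝ) / s with hP
  set a := ∑ s ∈ S, y s * ((Real.sqrt (s : ℝ) : ℝ) : ℂ)⁻¹ with ha
  have hP0 : 0 < P := by
    obtain ⟨r, hr⟩ := hS0
    have h1 := single_le_sum (f := fun s : ℕ => (1 : ℝ) / s) (fun s _ => by positivity) hr
    have : (0 : ℝ) < 1 / r := by have := hS r hr; positivity
    rw [hP]; linarith
  set m := a / ((P : ℝ) : ℂ) with hm
  -- expand termwise, then use `conj m · a = ‖a‖²/P = ‖m‖² P`
  have hterm : ∀ r ∈ S, (1 : ℝ) / r * ‖((Real.sqrt r : ℝ) : ℂ) * y r - m‖ ^ 2 =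
      ‖y r‖ ^ 2 - 2 * (starRingEnd ℂ m * (y r * ((Real.sqrt (r : ℝ) : ℝ) : ℂ)⁻¹)).re +
        ‖m‖ ^ 2 * ((1 : ℝ) / r) := by
    intro r hr
    have hr0 : (0 : ℝ) < r := by exact_mod_cast hS r hr
    obtain ⟨s, hs0, hsr⟩ : ∃ s : ℝ, 0 < s ∧ Real.sqrt r = s := ⟨_, Real.sqrt_pos.2 hr0, rfl⟩
    have hr2 : (r : ℝ) = s ^ 2 := by rw [← hsr, Real.sq_sqrt hr0.le]
    rw [hsr, hr2, ← Complex.ofReal_inv]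
    generalize y r = z
    generalize m = w
    have hs : s ≠ 0 := hs0.ne'
    simp only [Complex.sq_norm, Complex.normSq_apply, Complex.mul_re, Complex.mul_im, Complex.sub_re,
      Complex.sub_im, Complex.ofReal_re, Complex.ofReal_im, Complex.conj_re, Complex.conj_im]
    field_simp
    ring
  rw [sum_congr rfl hterm, sum_add_distrib, sum_sub_distrib, ← mul_sum, ← mul_sum, ← Complex.re_sum,
    ← mul_sum, ← ha, ← hP]
  have h1 : (starRingEnd ℂ m * a).re = ‖a‖ ^ 2 / P := by
    rw [hm, map_div₀, Complex.conj_ofReal, div_mul_eq_mul_div, Complex.div_ofReal_re,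
      Complex.conj_mul', ← Complex.ofReal_pow, Complex.ofReal_re]
  have h2 : ‖m‖ ^ 2 * P = ‖a‖ ^ 2 / P := by
    rw [hm, norm_div, Complex.norm_real, Real.norm_eq_abs, abs_of_pos hP0, div_pow]
    field_simp
  rw [h1, h2]
  ring

/-- **Remainder vs variance.** If `Σ_{r ∈ S} ρ_r = 0` then
`|Σ_S ρ_r √r y_r|² ≤ (Σ_S r ρ_r²) · (Σ_S ‖y_r‖² − |Σ_S y_r r^{-1/2}|²/Σ_S (1/r))`
(subtract the mean, then Cauchy–Schwarz with the weights `r` and `1/r`). -/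
theorem norm_sq_sum_mul_le_mul_variance (S : Finset ℕ) (hS : ∀ r ∈ S, 1 ≤ r) (hS0 : S.Nonempty)
    (ρ : ℕ → ℝ) (hρ : ∑ r ∈ S, ρ r = 0) (y : ℕ → ℂ) :
    ‖∑ r ∈ S, ((ρ r : ℝ) : ℂ) * (((Real.sqrt r : ℝ) : ℂ) * y r)‖ ^ 2 ≤
      (∑ r ∈ S, ρ r ^ 2 * r) *
        (∑ r ∈ S, ‖y r‖ ^ 2 -
          ‖∑ r ∈ S, y r * ((Real.sqrt (r : ℝ) : ℝ) : ℂ)⁻¹‖ ^ 2 / (∑ r ∈ S, (1 : ℝ) / r)) := by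
  set m := (∑ s ∈ S, y s * ((Real.sqrt (s : ℝ) : ℝ) : ℂ)⁻¹) / ((∑ s ∈ S, (1 : ℝ) / s : ℝ) : ℂ)
    with hm
  have e1 : ∑ r ∈ S, ((ρ r : ℝ) : ℂ) * (((Real.sqrt r : ℝ) : ℂ) * y r) =
      ∑ r ∈ S, ((ρ r : ℝ) : ℂ) * (((Real.sqrt r : ℝ) : ℂ) * y r - m) := by
    have : ∑ r ∈ S, ((ρ r : ℝ) : ℂ) * m = 0 := by
      rw [← sum_mul, ← Complex.ofReal_sum, hρ]; simp
    rw [← sub_zero (∑ r ∈ S, ((ρ r : ℝ) : ℂ) * (((Real.sqrt r : ℝ) : ℂ) * y r)), ← this,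
      ← sum_sub_distrib]
    exact sum_congr rfl fun r _ => by ring
  rw [e1, ← sum_div_norm_sub_mean_sq S hS hS0 y, ← hm]
  set u : ℕ → ℝ := fun r => |ρ r| * Real.sqrt r with hu
  set v : ℕ → ℝ := fun r => (Real.sqrt r)⁻¹ * ‖((Real.sqrt r : ℝ) : ℂ) * y r - m‖ with hv
  have hstep : ‖∑ r ∈ S, ((ρ r : ℝ) : ℂ) * (((Real.sqrt r : ℝ) : ℂ) * y r - m)‖ ≤
      ∑ r ∈ S, u r * v r := by
    refine (norm_sum_le _ _).trans (le_of_eq (sum_congr rfl fun r hr => ?_))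
    have hr0 : (0 : ℝ) < r := by exact_mod_cast hS r hr
    have hs0 : 0 < Real.sqrt r := Real.sqrt_pos.2 hr0
    rw [norm_mul, Complex.norm_real, Real.norm_eq_abs, hu, hv]
    field_simp
  have hCS := sum_mul_sq_le_sq_mul_sq S u v
  have eu : ∑ r ∈ S, u r ^ 2 = ∑ r ∈ S, ρ r ^ 2 * r := by
    refine sum_congr rfl fun r hr => ?_
    simp only [hu]
    rw [mul_pow, sq_abs, Real.sq_sqrt (Nat.cast_nonneg r)]
  have ev : ∑ r ∈ S, v r ^ 2 =
      ∑ r ∈ S, (1 : ℝ) / r * ‖((Real.sqrt r : ℝ) : ℂ) * y r - m‖ ^ 2 := by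
    refine sum_congr rfl fun r hr => ?_
    simp only [hv]
    rw [mul_pow, inv_pow, Real.sq_sqrt (Nat.cast_nonneg r), one_div]
  rw [eu, ev] at hCS
  exact (pow_le_pow_left₀ (norm_nonneg _) hstep 2).trans hCS

/-- **Flow pairing vs energy** (Cauchy–Schwarz along the edges `r → nr`). For a flow `G` supported
on prime-power multipliers (`Λ(n) = 0 → G r n = 0`), in the gauge `b_k = √k y_k`,
`|Σ_r Σ_n G(r,n) (b_r − b_{nr})|² ≤ (Σ_r Σ_n G(r,n)² nr/Λ(n)) · Σ_r Σ_n Λ(n) ‖y(nr) − n^{-1/2} y(r)‖²`. -/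
theorem norm_sq_flow_pairing_le (S : Finset ℕ) (N : ℕ → Finset ℕ) (hN : ∀ r n, n ∈ N r → 1 ≤ n)
    (G : ℕ → ℕ → ℝ) (hG0 : ∀ r n, Λ n = 0 → G r n = 0) (y : ℕ → ℂ) :
    ‖∑ r ∈ S, ∑ n ∈ N r, ((G r n : ℝ) : ℂ) *
        (((Real.sqrt r : ℝ) : ℂ) * y r - ((Real.sqrt ((n * r : ℕ) : ℝ) : ℝ) : ℂ) * y (n * r))‖ ^ 2 ≤
      (∑ r ∈ S, ∑ n ∈ N r, G r n ^ 2 * ((n * r : ℕ) : ℝ) / Λ n) *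
        ∑ r ∈ S, ∑ n ∈ N r, (Λ n : ℝ) *
          ‖y (n * r) - ((Real.sqrt n : ℂ))⁻¹ * y r‖ ^ 2 := by
  set T := S.sigma N with hT
  set a : (Σ _ : ℕ, ℕ) → ℝ := fun x =>
    |G x.1 x.2| * Real.sqrt (((x.2 * x.1 : ℕ) : ℝ) / Λ x.2) with ha
  set cc : (Σ _ : ℕ, ℕ) → ℝ := fun x =>
    Real.sqrt (Λ x.2) * ‖y (x.2 * x.1) - ((Real.sqrt x.2 : ℂ))⁻¹ * y x.1‖ with hcc
  have hedge : ∀ r n : ℕ, 1 ≤ n →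
      ‖((Real.sqrt r : ℝ) : ℂ) * y r - ((Real.sqrt ((n * r : ℕ) : ℝ) : ℝ) : ℂ) * y (n * r)‖ =
        Real.sqrt ((n * r : ℕ) : ℝ) * ‖y (n * r) - ((Real.sqrt n : ℂ))⁻¹ * y r‖ := by
    intro r n hn
    have hn0 : (0 : ℝ) < n := by exact_mod_cast Nat.lt_of_lt_of_le Nat.zero_lt_one hn
    have hsn : (Real.sqrt n : ℂ) ≠ 0 := by exact_mod_cast (Real.sqrt_pos.2 hn0).ne'
    have hsplit : ((Real.sqrt ((n * r : ℕ) : ℝ) : ℝ) : ℂ) = (Real.sqrt n : ℂ) * ((Real.sqrt r : ℝ) : ℂ) := by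
      rw [Nat.cast_mul, Real.sqrt_mul (Nat.cast_nonneg n)]; push_cast; ring
    have e : ((Real.sqrt r : ℝ) : ℂ) * y r - ((Real.sqrt ((n * r : ℕ) : ℝ) : ℝ) : ℂ) * y (n * r) =
        -(((Real.sqrt ((n * r : ℕ) : ℝ) : ℝ) : ℂ) * (y (n * r) - ((Real.sqrt n : ℂ))⁻¹ * y r)) := by
      rw [hsplit]; field_simp; ring
    rw [e, norm_neg, norm_mul, Complex.norm_real, Real.norm_eq_abs, abs_of_nonneg (Real.sqrt_nonneg _)]
  have hterm : ∀ x ∈ T, ‖((G x.1 x.2 : ℝ) : ℂ) * (((Real.sqrt x.1 : ℝ) : ℂ) * y x.1 -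
      ((Real.sqrt ((x.2 * x.1 : ℕ) : ℝ) : ℝ) : ℂ) * y (x.2 * x.1))‖ ≤ a x * cc x := by
    rintro ⟨r, n⟩ hx
    have hn : 1 ≤ n := hN r n (mem_sigma.1 hx).2
    simp only [ha, hcc]
    rw [norm_mul, Complex.norm_real, Real.norm_eq_abs, hedge r n hn]
    by_cases hL : Λ n = 0
    · rw [hG0 r n hL]; simp
    · have hL0 : 0 < (Λ n : ℝ) := lt_of_le_of_ne vonMangoldt_nonneg (Ne.symm hL)
      have e : Real.sqrt (((n * r : ℕ) : ℝ) / Λ n) * Real.sqrt (Λ n) = Real.sqrt ((n * r : ℕ) : ℝ) := by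
        rw [← Real.sqrt_mul (by positivity), div_mul_cancel₀ _ hL]
      rw [← e]
      exact le_of_eq (by ring)
  have h1 : ‖∑ r ∈ S, ∑ n ∈ N r, ((G r n : ℝ) : ℂ) *
      (((Real.sqrt r : ℝ) : ℂ) * y r - ((Real.sqrt ((n * r : ℕ) : ℝ) : ℝ) : ℂ) * y (n * r))‖ ≤
      ∑ x ∈ T, a x * cc x := by
    rw [hT, sum_sigma]
    refine (norm_sum_le _ _).trans (sum_le_sum fun r hr => (norm_sum_le _ _).trans ?_)
    exact sum_le_sum fun n hn => hterm ⟨r, n⟩ (mem_sigma.2 ⟨hr, hn⟩)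
  have hCS := sum_mul_sq_le_sq_mul_sq T a cc
  have ea : ∑ x ∈ T, a x ^ 2 = ∑ r ∈ S, ∑ n ∈ N r, G r n ^ 2 * ((n * r : ℕ) : ℝ) / Λ n := by
    rw [hT, sum_sigma]
    refine sum_congr rfl fun r _ => sum_congr rfl fun n _ => ?_
    rw [mul_pow, sq_abs, Real.sq_sqrt (div_nonneg (Nat.cast_nonneg _) vonMangoldt_nonneg), mul_div_assoc]
  have ec : ∑ x ∈ T, cc x ^ 2 =
      ∑ r ∈ S, ∑ n ∈ N r, (Λ n : ℝ) * ‖y (n * r) - ((Real.sqrt n : ℂ))⁻¹ * y r‖ ^ 2 := by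
    rw [hT, sum_sigma]
    refine sum_congr rfl fun r _ => sum_congr rfl fun n _ => ?_
    rw [mul_pow, Real.sq_sqrt vonMangoldt_nonneg]
  rw [ea, ec] at hCS
  exact (pow_le_pow_left₀ (norm_nonneg _) h1 2).trans hCS

/-! ## The discrete Green identity on the odd divisor graph -/

/-- **Discrete Green identity** on the odd divisor graph (`r ≤ M` odd, edges `r → nr`, `n ≤ M/r` odd):
`Σ_r g(r)·(out(r) − in(r)) = Σ_r Σ_n G(r,n) (g(r) − g(nr))`, `out(r) = Σ_{n ≤ M/r odd} G(r,n)`,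
`in(r) = Σ_{n ∣ r odd} G(r/n, n)` (reindex the incoming edges by their tail `r/n`). -/
theorem sum_mul_flowDiv_eq (M : ℕ) (G : ℕ → ℕ → ℝ) (g : ℕ → ℂ) :
    ∑ r ∈ (Icc 1 M).filter (fun r => Odd r), g r *
        (((∑ n ∈ (Icc 1 (M / r)).filter (fun n => Odd n), G r n) -
            ∑ n ∈ (Icc 1 r).filter (fun n => Odd n ∧ n ∣ r), G (r / n) n : ℝ) : ℂ) =
      ∑ r ∈ (Icc 1 M).filter (fun r => Odd r), ∑ n ∈ (Icc 1 (M / r)).filter (fun n => Odd n),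
        ((G r n : ℝ) : ℂ) * (g r - g (n * r)) := by
  set O := (Icc 1 M).filter (fun r => Odd r) with hO
  have key : ∑ r ∈ O, ∑ n ∈ (Icc 1 r).filter (fun n => Odd n ∧ n ∣ r), ((G (r / n) n : ℝ) : ℂ) * g r =
      ∑ r ∈ O, ∑ n ∈ (Icc 1 (M / r)).filter (fun n => Odd n), ((G r n : ℝ) : ℂ) * g (n * r) := by
    rw [sum_sigma', sum_sigma']
    refine sum_nbij' (fun x => ⟨x.1 / x.2, x.2⟩) (fun x => ⟨x.2 * x.1, x.2⟩) ?_ ?_ ?_ ?_ ?_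
    · rintro ⟨r, n⟩ hx
      simp only [hO, mem_sigma, mem_filter, mem_Icc] at hx
      obtain ⟨⟨⟨hr1, hrM⟩, hrodd⟩, ⟨hn1, hnr⟩, hnodd, hdvd⟩ := hx
      have hq : 0 < r / n := Nat.div_pos hnr hn1
      simp only [hO, mem_sigma, mem_filter, mem_Icc]
      refine ⟨⟨⟨hq, (Nat.div_le_self r n).trans hrM⟩, hrodd.of_dvd_nat (Nat.div_dvd_of_dvd hdvd)⟩,
        ⟨hn1, ?_⟩, hnodd⟩
      rw [Nat.le_div_iff_mul_le hq, Nat.mul_div_cancel' hdvd]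
      exact hrM
    · rintro ⟨r, n⟩ hx
      simp only [hO, mem_sigma, mem_filter, mem_Icc] at hx
      obtain ⟨⟨⟨hr1, hrM⟩, hrodd⟩, ⟨hn1, hnM⟩, hnodd⟩ := hx
      simp only [hO, mem_sigma, mem_filter, mem_Icc]
      refine ⟨⟨⟨Nat.mul_pos hn1 hr1, (Nat.le_div_iff_mul_le hr1).1 hnM⟩, Nat.odd_mul.2 ⟨hnodd, hrodd⟩⟩,
        ⟨hn1, Nat.le_mul_of_pos_right n hr1⟩, hnodd, dvd_mul_right n r⟩
    · rintro ⟨r, n⟩ hx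
      simp only [hO, mem_sigma, mem_filter, mem_Icc] at hx
      simp only [Nat.mul_div_cancel' hx.2.2.2]
    · rintro ⟨r, n⟩ hx
      simp only [hO, mem_sigma, mem_filter, mem_Icc] at hx
      simp only [Nat.mul_div_cancel_left r hx.2.1.1]
    · rintro ⟨r, n⟩ hx
      simp only [hO, mem_sigma, mem_filter, mem_Icc] at hx
      simp only [Nat.mul_div_cancel' hx.2.2.2]
  have e1 : ∀ r ∈ O, g r *
      (((∑ n ∈ (Icc 1 (M / r)).filter (fun n => Odd n), G r n) -
          ∑ n ∈ (Icc 1 r).filter (fun n => Odd n ∧ n ∣ r), G (r / n) n : ℝ) : ℂ) =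
      ∑ n ∈ (Icc 1 (M / r)).filter (fun n => Odd n), ((G r n : ℝ) : ℂ) * g r -
        ∑ n ∈ (Icc 1 r).filter (fun n => Odd n ∧ n ∣ r), ((G (r / n) n : ℝ) : ℂ) * g r := by
    intro r _
    push_cast
    rw [mul_sub, mul_sum, mul_sum]
    exact congrArg₂ _ (sum_congr rfl fun n _ => mul_comm _ _) (sum_congr rfl fun n _ => mul_comm _ _)
  rw [sum_congr rfl e1, sum_sub_distrib, key, ← sum_sub_distrib]
  refine sum_congr rfl fun r _ => ?_
  rw [← sum_sub_distrib]
  exact sum_congr rfl fun n _ => by ring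

/-- The rank-one term of `R(M)` as a pairing: with `θ_r = 1 − 2^{-⌊log₂(M/r)⌋}`,
`T/πE − aO/πO = Σ_{r odd} w_r · (√r y_r)`, `w_r = ((θ_r/πE − 1/πO))/r`. -/
theorem oddBlock_rankOne_eq_pairing (M : ℕ) (y : ℕ → ℂ) :
    (∑ r ∈ (Icc 1 M).filter (fun r => Odd r),
          y r * ((Real.sqrt (r : ℝ) : ℝ) : ℂ)⁻¹ * (1 - ((2 : ℂ) ^ Nat.log 2 (M / r))⁻¹)) /
        ((∑ k ∈ (Icc 1 M).filter (fun k => Even k), (1 : ℝ) / k : ℝ) : ℂ) -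
      (∑ r ∈ (Icc 1 M).filter (fun r => Odd r), y r * ((Real.sqrt (r : ℝ) : ℝ) : ℂ)⁻¹) /
        ((∑ r ∈ (Icc 1 M).filter (fun r => Odd r), (1 : ℝ) / r : ℝ) : ℂ) =
      ∑ r ∈ (Icc 1 M).filter (fun r => Odd r),
        ((((1 - ((2 : ℝ) ^ Nat.log 2 (M / r))⁻¹) /
              (∑ k ∈ (Icc 1 M).filter (fun k => Even k), (1 : ℝ) / k) -
            1 / (∑ s ∈ (Icc 1 M).filter (fun s => Odd s), (1 : ℝ) / s)) / r : ℝ) : ℂ) *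
          (((Real.sqrt r : ℝ) : ℂ) * y r) := by
  set O := (Icc 1 M).filter (fun r => Odd r) with hO
  set PE := ∑ k ∈ (Icc 1 M).filter (fun k => Even k), (1 : ℝ) / k with hPE
  set PO := ∑ s ∈ O, (1 : ℝ) / s with hPO
  rw [sum_div, sum_div, ← sum_sub_distrib]
  refine sum_congr rfl fun r hr => ?_
  have hr0 : (0 : ℝ) < r := by exact_mod_cast (mem_Icc.1 (mem_filter.1 hr).1).1
  obtain ⟨s, hs0, hsr⟩ : ∃ s : ℝ, 0 < s ∧ Real.sqrt r = s := ⟨_, Real.sqrt_pos.2 hr0, rfl⟩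
  have hs : (s : ℂ) ≠ 0 := by exact_mod_cast hs0.ne'
  have hr2 : ((r : ℕ) : ℂ) = (s : ℂ) * s := by
    have : (r : ℝ) = s * s := by rw [← hsr, Real.mul_self_sqrt hr0.le]
    exact_mod_cast this
  push_cast
  rw [hsr, hr2]
  have e : ((1 - ((2 : ℂ) ^ Nat.log 2 (M / r))⁻¹) / (PE : ℂ) - 1 / (PO : ℂ)) / ((s : ℂ) * s) *
      ((s : ℂ) * y r) =
      ((1 - ((2 : ℂ) ^ Nat.log 2 (M / r))⁻¹) / (PE : ℂ) - 1 / (PO : ℂ)) * (y r * (s : ℂ)⁻¹) := by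
    field_simp
  rw [e]; ring

/-- **Flow decoupling of `R(M)`.** Let `M ≥ 6`, `O` = odd numbers `≤ M`, `πO = Σ_O 1/r`,
`πE = Σ_{k ≤ M even} 1/k`, `H = Σ_{m ≤ M} 1/m`, `K = log 2·πO·πE/(log 2·H − πO)`,
`w_r = ((1 − 2^{-⌊log₂(M/r)⌋})/πE − 1/πO)/r`.  If (`hgap`) `c·(Σ_O ‖y_r‖² − |Σ_O y_r r^{-1/2}|²/πO) ≤ E_O(y)`
for all `y` (plain gap `c > 0` of the odd divisor graph at `M`), and a certificate `(G, ρ)` is given —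
`G r n` a flow on the edges `r → nr` vanishing off prime powers, `out(r) − in(r) = w_r − ρ_r` on `O`,
`Σ_O ρ = 0`, `K·Σ G(r,n)² nr/Λ(n) ≤ κ₁`, `K·Σ_O r ρ_r² ≤ κ₀` — with `(1 + (1+t⁻¹)κ₀)/c + (1+t)κ₁ ≤ 1`
for some `t > 0`, then `R(M)` (hypothesis `hR` of `divisorGap_parityStep` = the registered
`stub_divisorGapOddBlock24` at this `M`) holds for every `y`. -/
theorem oddBlock_of_gap_of_flow (M : ℕ) (hM : 6 ≤ M) {c κ₀ κ₁ t : ℝ} (hc : 0 < c) (ht : 0 < t)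
    (G : ℕ → ℕ → ℝ) (ρ : ℕ → ℝ)
    (hgap : ∀ y : ℕ → ℂ,
      c * (∑ r ∈ (Icc 1 M).filter (fun r => Odd r), ‖y r‖ ^ 2 -
          ‖∑ r ∈ (Icc 1 M).filter (fun r => Odd r), y r * ((Real.sqrt (r : ℝ) : ℝ) : ℂ)⁻¹‖ ^ 2 /
            (∑ r ∈ (Icc 1 M).filter (fun r => Odd r), (1 : ℝ) / r)) ≤
        ∑ r ∈ (Icc 1 M).filter (fun r => Odd r), ∑ n ∈ (Icc 1 (M / r)).filter (fun n => Odd n),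
          (ArithmeticFunction.vonMangoldt n : ℝ) * ‖y (n * r) - ((Real.sqrt n : ℂ))⁻¹ * y r‖ ^ 2)
    (hG0 : ∀ r n, ArithmeticFunction.vonMangoldt n = 0 → G r n = 0)
    (hdiv : ∀ r ∈ (Icc 1 M).filter (fun r => Odd r),
      (∑ n ∈ (Icc 1 (M / r)).filter (fun n => Odd n), G r n) -
          ∑ n ∈ (Icc 1 r).filter (fun n => Odd n ∧ n ∣ r), G (r / n) n =
        ((1 - ((2 : ℝ) ^ Nat.log 2 (M / r))⁻¹) /
              (∑ k ∈ (Icc 1 M).filter (fun k => Even k), (1 : ℝ) / k) -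
            1 / (∑ s ∈ (Icc 1 M).filter (fun s => Odd s), (1 : ℝ) / s)) / r - ρ r)
    (hρ : ∑ r ∈ (Icc 1 M).filter (fun r => Odd r), ρ r = 0)
    (hen : Real.log 2 * (∑ r ∈ (Icc 1 M).filter (fun r => Odd r), (1 : ℝ) / r) *
            (∑ k ∈ (Icc 1 M).filter (fun k => Even k), (1 : ℝ) / k) /
          (Real.log 2 * (∑ m ∈ Icc 1 M, (1 : ℝ) / m) -
            ∑ r ∈ (Icc 1 M).filter (fun r => Odd r), (1 : ℝ) / r) *
        ∑ r ∈ (Icc 1 M).filter (fun r => Odd r), ∑ n ∈ (Icc 1 (M / r)).filter (fun n => Odd n),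
          G r n ^ 2 * ((n * r : ℕ) : ℝ) / ArithmeticFunction.vonMangoldt n ≤ κ₁)
    (hP : Real.log 2 * (∑ r ∈ (Icc 1 M).filter (fun r => Odd r), (1 : ℝ) / r) *
            (∑ k ∈ (Icc 1 M).filter (fun k => Even k), (1 : ℝ) / k) /
          (Real.log 2 * (∑ m ∈ Icc 1 M, (1 : ℝ) / m) -
            ∑ r ∈ (Icc 1 M).filter (fun r => Odd r), (1 : ℝ) / r) *
        ∑ r ∈ (Icc 1 M).filter (fun r => Odd r), ρ r ^ 2 * r ≤ κ₀)
    (hclose : (1 + (1 + t⁻¹) * κ₀) / c + (1 + t) * κ₁ ≤ 1) :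
    ∀ (y : ℕ → ℂ),
      ∑ r ∈ (Icc 1 M).filter (fun r => Odd r), ‖y r‖ ^ 2 -
        ‖∑ r ∈ (Icc 1 M).filter (fun r => Odd r), y r * ((Real.sqrt (r : ℝ) : ℝ) : ℂ)⁻¹‖ ^ 2 /
          (∑ r ∈ (Icc 1 M).filter (fun r => Odd r), (1 : ℝ) / r) +
        Real.log 2 * (∑ r ∈ (Icc 1 M).filter (fun r => Odd r), (1 : ℝ) / r) *
            (∑ k ∈ (Icc 1 M).filter (fun k => Even k), (1 : ℝ) / k) /
          (Real.log 2 * (∑ m ∈ Icc 1 M, (1 : ℝ) / m) -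
            ∑ r ∈ (Icc 1 M).filter (fun r => Odd r), (1 : ℝ) / r) *
        ‖(∑ r ∈ (Icc 1 M).filter (fun r => Odd r),
              y r * ((Real.sqrt (r : ℝ) : ℝ) : ℂ)⁻¹ * (1 - ((2 : ℂ) ^ Nat.log 2 (M / r))⁻¹)) /
            ((∑ k ∈ (Icc 1 M).filter (fun k => Even k), (1 : ℝ) / k : ℝ) : ℂ) -
          (∑ r ∈ (Icc 1 M).filter (fun r => Odd r), y r * ((Real.sqrt (r : ℝ) : ℝ) : ℂ)⁻¹) /
            ((∑ r ∈ (Icc 1 M).filter (fun r => Odd r), (1 : ℝ) / r : ℝ) : ℂ)‖ ^ 2 ≤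
      ∑ r ∈ (Icc 1 M).filter (fun r => Odd r), ∑ n ∈ (Icc 1 (M / r)).filter (fun n => Odd n),
        (ArithmeticFunction.vonMangoldt n : ℝ) * ‖y (n * r) - ((Real.sqrt n : ℂ))⁻¹ * y r‖ ^ 2 := by
  intro y
  set O := (Icc 1 M).filter (fun r => Odd r) with hO
  set PO := ∑ r ∈ O, (1 : ℝ) / r with hPO
  set PE := ∑ k ∈ (Icc 1 M).filter (fun k => Even k), (1 : ℝ) / k with hPE
  set K := Real.log 2 * PO * PE / (Real.log 2 * (∑ m ∈ Icc 1 M, (1 : ℝ) / m) - PO) with hK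
  set w : ℕ → ℝ := fun r => ((1 - ((2 : ℝ) ^ Nat.log 2 (M / r))⁻¹) / PE - 1 / PO) / r with hw
  set b : ℕ → ℂ := fun r => ((Real.sqrt r : ℝ) : ℂ) * y r with hb
  set V := ∑ r ∈ O, ‖y r‖ ^ 2 - ‖∑ r ∈ O, y r * ((Real.sqrt (r : ℝ) : ℝ) : ℂ)⁻¹‖ ^ 2 / PO with hV
  set D := ∑ r ∈ O, ∑ n ∈ (Icc 1 (M / r)).filter (fun n => Odd n),
    (ArithmeticFunction.vonMangoldt n : ℝ) * ‖y (n * r) - ((Real.sqrt n : ℂ))⁻¹ * y r‖ ^ 2 with hD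
  set en := ∑ r ∈ O, ∑ n ∈ (Icc 1 (M / r)).filter (fun n => Odd n),
    G r n ^ 2 * ((n * r : ℕ) : ℝ) / ArithmeticFunction.vonMangoldt n with hen'
  set Pρ := ∑ r ∈ O, ρ r ^ 2 * r with hPρ
  set X := (∑ r ∈ O, y r * ((Real.sqrt (r : ℝ) : ℝ) : ℂ)⁻¹ * (1 - ((2 : ℂ) ^ Nat.log 2 (M / r))⁻¹)) /
      ((PE : ℝ) : ℂ) - (∑ r ∈ O, y r * ((Real.sqrt (r : ℝ) : ℝ) : ℂ)⁻¹) / ((PO : ℝ) : ℂ) with hX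
  have hO1 : ∀ r ∈ O, 1 ≤ r := fun r hr => (mem_Icc.1 (mem_filter.1 hr).1).1
  have hOne : O.Nonempty := ⟨1, by rw [hO, mem_filter, mem_Icc]; exact ⟨⟨le_rfl, by omega⟩, odd_one⟩⟩
  have hH : ∑ m ∈ Icc 1 M, (1 : ℝ) / m = PO + PE := by
    rw [hPO, hPE, hO, ← filter_congr (fun k _ => Nat.not_odd_iff_even (n := k)),
      sum_filter_add_sum_filter_not]
  have hL : PO < Real.log 2 * (PO + PE) := sum_odd_inv_lt_log_two_mul hM
  have hPO0 : 0 ≤ PO := sum_nonneg fun k _ => by positivity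
  have hPE0 : 0 ≤ PE := sum_nonneg fun k _ => by positivity
  have hK0 : 0 ≤ K := by
    rw [hK, hH]
    exact div_nonneg (mul_nonneg (mul_nonneg (Real.log_nonneg (by norm_num)) hPO0) hPE0)
      (sub_pos.2 hL).le
  have hD0 : 0 ≤ D := sum_nonneg fun r _ => sum_nonneg fun n _ => by positivity
  have hV0 : 0 ≤ V := by
    rw [hV, ← sum_div_norm_sub_mean_sq O hO1 hOne y]
    exact sum_nonneg fun r _ => by positivity
  have hκ₀ : 0 ≤ κ₀ := le_trans (mul_nonneg hK0 (sum_nonneg fun r _ => by positivity)) hP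
  have hXw : X = ∑ r ∈ O, ((w r : ℝ) : ℂ) * b r := oddBlock_rankOne_eq_pairing M y
  set X1 := ∑ r ∈ O, ∑ n ∈ (Icc 1 (M / r)).filter (fun n => Odd n),
    ((G r n : ℝ) : ℂ) * (b r - b (n * r)) with hX1
  set X2 := ∑ r ∈ O, ((ρ r : ℝ) : ℂ) * b r with hX2
  have hsplit : X = X1 + X2 := by
    rw [hXw, hX1, ← sum_mul_flowDiv_eq M G b, hX2, ← sum_add_distrib]
    refine sum_congr rfl fun r hr => ?_
    rw [hdiv r hr]
    simp only [hw]
    push_cast; ring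
  have h1 : ‖X1‖ ^ 2 ≤ en * D :=
    norm_sq_flow_pairing_le O (fun r => (Icc 1 (M / r)).filter (fun n => Odd n))
      (fun r n hn => (mem_Icc.1 (mem_filter.1 hn).1).1) G hG0 y
  have h2 : ‖X2‖ ^ 2 ≤ Pρ * V := norm_sq_sum_mul_le_mul_variance O hO1 hOne ρ hρ y
  have h3 : ‖X‖ ^ 2 ≤ (1 + t) * ‖X1‖ ^ 2 + (1 + t⁻¹) * ‖X2‖ ^ 2 := by
    have hle : ‖X‖ ≤ ‖X1‖ + ‖X2‖ := by rw [hsplit]; exact norm_add_le _ _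
    have hsq : ‖X‖ ^ 2 ≤ (‖X1‖ + ‖X2‖) ^ 2 := pow_le_pow_left₀ (norm_nonneg _) hle 2
    have e : (1 + t) * ‖X1‖ ^ 2 + (1 + t⁻¹) * ‖X2‖ ^ 2 - (‖X1‖ + ‖X2‖) ^ 2 =
        (t * ‖X1‖ - ‖X2‖) ^ 2 / t := by field_simp; ring
    have : 0 ≤ (t * ‖X1‖ - ‖X2‖) ^ 2 / t := by positivity
    linarith
  have hVD : V ≤ D / c := by rw [le_div_iff₀ hc, mul_comm]; exact hgap y
  have h4 : K * ‖X‖ ^ 2 ≤ (1 + t) * κ₁ * D + (1 + t⁻¹) * κ₀ * V := by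
    have ht1 : 0 ≤ 1 + t := by linarith
    have ht2 : 0 ≤ 1 + t⁻¹ := by positivity
    calc K * ‖X‖ ^ 2 ≤ K * ((1 + t) * ‖X1‖ ^ 2 + (1 + t⁻¹) * ‖X2‖ ^ 2) :=
          mul_le_mul_of_nonneg_left h3 hK0
      _ ≤ K * ((1 + t) * (en * D) + (1 + t⁻¹) * (Pρ * V)) := mul_le_mul_of_nonneg_left
          (add_le_add (mul_le_mul_of_nonneg_left h1 ht1) (mul_le_mul_of_nonneg_left h2 ht2)) hK0
      _ = (1 + t) * (K * en) * D + (1 + t⁻¹) * (K * Pρ) * V := by ring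
      _ ≤ (1 + t) * κ₁ * D + (1 + t⁻¹) * κ₀ * V :=
          add_le_add (mul_le_mul_of_nonneg_right (mul_le_mul_of_nonneg_left hen ht1) hD0)
            (mul_le_mul_of_nonneg_right (mul_le_mul_of_nonneg_left hP ht2) hV0)
  have h5 : (1 + (1 + t⁻¹) * κ₀) * V ≤ (1 + (1 + t⁻¹) * κ₀) * (D / c) :=
    mul_le_mul_of_nonneg_left hVD (by positivity)
  have h6 : (1 + (1 + t⁻¹) * κ₀) * (D / c) + (1 + t) * κ₁ * D ≤ D := by
    have : (1 + (1 + t⁻¹) * κ₀) * (D / c) + (1 + t) * κ₁ * D =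
        D * ((1 + (1 + t⁻¹) * κ₀) / c + (1 + t) * κ₁) := by ring
    rw [this]; exact (mul_le_mul_of_nonneg_left hclose hD0).trans (le_of_eq (mul_one D))
  change V + K * ‖X‖ ^ 2 ≤ D
  linarith [h4, h5, h6]

/-- **Registered form (`stub_divisorGapOddBlockDecoupling`, uncurried) of `oddBlock_of_gap_of_flow`**:
plain gap `c` of the odd divisor graph + an explicit flow/remainder certificate `(G, ρ)` imply `R(M)`. -/
theorem stub_divisorGapOddBlockDecoupling : ∀ (M : ℕ), 6 ≤ M → ∀ (c κ₀ κ₁ t : ℝ), 0 < c → 0 < t → ∀ (G : ℕ → ℕ → ℝ) (ρ : ℕ → ℝ), (∀ y : ℕ → ℂ, c * (∑ r ∈ (Icc 1 M).filter (fun r => Odd r), ‖y r‖ ^ 2 - ‖∑ r ∈ (Icc 1 M).filter (fun r => Odd r), y r * ((Real.sqrt (r : ℝ) : ℝ) : ℂ)⁻¹‖ ^ 2 / (∑ r ∈ (Icc 1 M).filter (fun r => Odd r), (1 : ℝ) / r)) ≤ ∑ r ∈ (Icc 1 M).filter (fun r => Odd r), ∑ n ∈ (Icc 1 (M / r)).filter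 (fun n => Odd n), (ArithmeticFunction.vonMangoldt n : ℝ) * ‖y (n * r) - ((Real.sqrt n : ℂ))⁻¹ * y r‖ ^ 2) → (∀ r n, ArithmeticFunction.vonMangoldt n = 0 → G r n = 0) → (∀ r ∈ (Icc 1 M).filter (fun r => Odd r), (∑ n ∈ (Icc 1 (M / r)).filter (fun n => Odd n), G r n) - ∑ n ∈ (Icc 1 r).filter (fun n => Odd n ∧ n ∣ r), G (r / n) n = ((1 - ((2 : ℝ) ^ Nat.log 2 (M / r))⁻¹) / (∑ k ∈ (Icc 1 M).filter (fun k => Even k), (1 : ℝ) / k) - 1 / (∑ s ∈ (Icc 1 M).filter (fun s => Odd s), (1 : ℝ) / s)) / r - ρ r) → (∑ r ∈ (Icc 1 M).filter (fun r => Odd r), ρ r = 0) → (Real.log 2 * (∑ r ∈ (Icc 1 M).filter (fun r => Odd r), (1 : ℝ) / r) * (∑ k ∈ (Icc 1 M).filter (fun k => Even k), (1 : ℝ) / k) / (Real.log 2 * (∑ m ∈ Icc 1 M, (1 : ℝ) / m) - ∑ r ∈ (Icc 1 M).filter (fun r => Odd r), (1 : ℝ) / r) * ∑ r ∈ (Icc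 1 M).filter (fun r => Odd r), ∑ n ∈ (Icc 1 (M / r)).filter (fun n => Odd n), G r n ^ 2 * ((n * r : ℕ) : ℝ) / ArithmeticFunction.vonMangoldt n ≤ κ₁) → (Real.log 2 * (∑ r ∈ (Icc 1 M).filter (fun r => Odd r), (1 : ℝ) / r) * (∑ k ∈ (Icc 1 M).filter (fun k => Even k), (1 : ℝ) / k) / (Real.log 2 * (∑ m ∈ Icc 1 M, (1 : ℝ) / m) - ∑ r ∈ (Icc 1 M).filter (fun r => Odd r), (1 : ℝ) / r) * ∑ r ∈ (Icc 1 M).filter (fun r => Odd r), ρ r ^ 2 * r ≤ κ₀) → ((1 + (1 + t⁻¹) * κ₀) / c + (1 + t) * κ₁ ≤ 1) → ∀ (y : ℕ → ℂ), ∑ r ∈ (Icc 1 M).filter (fun r => Odd r), ‖y r‖ ^ 2 - ‖∑ r ∈ (Icc 1 M).filter (fun r => Odd r), y r * ((Real.sqrt (r : ℝ) : ℝ) : ℂ)⁻¹‖ ^ 2 / (∑ r ∈ (Icc 1 M).filter (fun r => Odd r), (1 : ℝ) / r) + Real.log 2 * (∑ r ∈ (Icc 1 M).filter (fun r => Odd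 r), (1 : ℝ) / r) * (∑ k ∈ (Icc 1 M).filter (fun k => Even k), (1 : ℝ) / k) / (Real.log 2 * (∑ m ∈ Icc 1 M, (1 : ℝ) / m) - ∑ r ∈ (Icc 1 M).filter (fun r => Odd r), (1 : ℝ) / r) * ‖(∑ r ∈ (Icc 1 M).filter (fun r => Odd r), y r * ((Real.sqrt (r : ℝ) : ℝ) : ℂ)⁻¹ * (1 - ((2 : ℂ) ^ Nat.log 2 (M / r))⁻¹)) / ((∑ k ∈ (Icc 1 M).filter (fun k => Even k), (1 : ℝ) / k : ℝ) : ℂ) - (∑ r ∈ (Icc 1 M).filter (fun r => Odd r), y r * ((Real.sqrt (r : ℝ) : ℝ) : ℂ)⁻¹) / ((∑ r ∈ (Icc 1 M).filter (fun r => Odd r), (1 : ℝ) / r : ℝ) : ℂ)‖ ^ 2 ≤ ∑ r ∈ (Icc 1 M).filter (fun r => Odd r), ∑ n ∈ (Icc 1 (M / r)).filter (fun n => Odd n), (ArithmeticFunction.vonMangoldt n : ℝ) * ‖y (n * r) - ((Real.sqrt n : ℂ))⁻¹ * y r‖ ^ 2 :=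
  fun M hM _ _ _ _ hc ht G ρ hgap hG0 hdiv hρ hen hP hclose =>
    oddBlock_of_gap_of_flow M hM hc ht G ρ hgap hG0 hdiv hρ hen hP hclose

end Summit.RiemannHypothesis.RiemannHypothesis.Theorems.WeilCombBohrFejer

end
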